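import Summits.Ventures.LatticeQCDFlow.Scaling.ParallelTemperingSwapKernelBalance

/-!
HONEST FRAMING: exact (Metropolis-corrected) sampling algorithms for lattice gauge theory; figures
of merit are autocorrelation/cost numbers at stated couplings and volumes; no continuum-physics
claim.

# ParallelTemperingPairSwapKernel — THE SWAP ATTEMPT AT A FIXED ADJACENT PAIR `(j, j+1)` AS A MARKOV KERNEL
# ON THE TAGGED SPACE: DETAILED BALANCE, EXACT TAG-MOVE PROBABILITY `ptTagCoef·ptPairRatio`, AND
# COMMUTATION OF THE KERNELS OF DISJOINT PAIRS (lean-2 GEN-15, ours)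

Venture-side (OURS).  Cell `lqcd-flow` (pub-lqcd), unit `pub-lqcd-lean-2-g15`, 2026-08-24.  GEN-14 constructed
the replica-exchange swap move with a UNIFORMLY CHOSEN pair (`Scaling/ParallelTemperingSwapKernel.ptSwapKernel`)
and listed "half-sweeps of disjoint pairs as one step" as NOT CLAIMED.  PTBC as run (Hasenbusch 2017;
Bonanno–Bonati–D'Elia 2021) proposes the swaps of ALL adjacent pairs once per cycle, in practice as the two
half-sweeps of the even pairs `(0,1), (2,3), …` and of the odd pairs `(1,2), (3,4), …`.  This file is the building
block: the swap attempt at ONE fixed pair as a kernel, its detailed balance, its exact tag-move probability, and the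
fact that the kernels of two DISJOINT pairs commute (so that a half-sweep — their composition — is again in detailed
balance; companion `Scaling/ParallelTemperingHalfSweep`).

## The kernel (`X : Ω → ℝ` measurable, levels `β : ℕ → ℝ`, pair `(j, j+1)`, `j < K`)

  `κ_j(τ, x) = r_j(x)·δ_{(σ_j τ, x∘σ_j)} + (1 − r_j(x))·δ_{(τ, x)}`,
  `r_j(x) = min(1, e^{(β_{j+1}−β_j)(X(x_j) − X(x_{j+1}))})` (`ptPairRatio`), `σ_j` the transposition of `j`, `j+1`.

## What is defined / proved

* §1 disjoint pairs (`j + 2 ≤ j'` or `j' + 2 ≤ j`, an inline hypothesis): the transpositions, configuration swaps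
  and proposal maps COMMUTE (`ptPerm_comm_of_apart` via Mathlib's `Equiv.Perm.disjoint_swap_swap`, `ptConfSwap_comm_of_apart`, `ptSwapMap_comm_of_apart`), the
  swap at `j` does not change the ratio at `j'` (`ptPairRatio_confSwap_of_apart`) and does not move a tag sitting
  on the pair `j'` (`ptPerm_eq_self_of_apart`).
* §2 **`ptPairKernel hXm β K j`** (a `Kernel`, Markov for every `K`), `ptPairKernel_apply'`,
  `lintegral_ptPairKernel`; consistency with GEN-14: `ptSwapKernel z s = K⁻¹·Σ_j ptPairKernel j z s`
  (`ptSwapKernel_apply_eq_sum_pairKernel`).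
* §3 `setLIntegral_ptPairKernel` (`∫⁻_A κ_j(·,B) dπ = (K+1)⁻¹·(T_j(A,B) + S_j(A,B))` with GEN-14's flux / stay
  functionals); **`isReversible_ptPairKernel`** (detailed balance w.r.t. `ptTaggedTarget`, from GEN-14's
  `ptSwapFlux_comm`); `invariant_ptPairKernel`.
* §4 (ii) `ptPairKernel_nearestNeighbour`; (iii) **`ptPairKernel_real_moves_eq`** —
  `κ_j(z){tag ≠ tag z} = ptTagCoef K j (tag z)·r_j(z)` EXACTLY (`= r_j` if the tag sits on the pair, else `0`),
  hence `≤ ptSwapRatio` (`ptPairKernel_real_moves_le`: GEN-13's replica-exchange law applies to `M ∘ₖ κ_j` verbatim).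
* §5 **`ptPairKernel_comm_of_apart`** — the kernels of disjoint pairs commute:
  `κ_{j'} ∘ₖ κ_j = κ_j ∘ₖ κ_{j'}`.

NOT CLAIMED here: the half-sweeps themselves (companion file); anything measured.  Literature grade (cell rule):
TEXTBOOK ALGORITHM (Swendsen–Wang 1986; Geyer 1991; Hukushima–Nemoto 1996; PTBC: Hasenbusch, PRD 96 (2017) 054504;
Bonanno–Bonati–D'Elia, JHEP 03 (2021) 111), NEW TYPING (Mathlib `Kernel` on a general measurable `Ω`); nothing
cited as a fact; no new bib keys.
-/

noncomputable section

open MeasureTheory ProbabilityTheory Set Filter Finset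
open scoped ENNReal

namespace Summit.Ventures.LatticeQCDFlow.Scaling

/-! ## §1 Disjoint pairs -/

section Apart

variable {Ω : Type*} {K : ℕ}

omit Ω in
/-- The four endpoints of two DISJOINT pairs (`j + 2 ≤ j'` or `j' + 2 ≤ j`) are distinct. [folklore] -/
theorem ptPair_ne_four_of_apart {j j' : Fin K} (h : (j : ℕ) + 2 ≤ j' ∨ (j' : ℕ) + 2 ≤ j) :
    Fin.castSucc j ≠ Fin.castSucc j' ∧ Fin.castSucc j ≠ Fin.succ j' ∧
      Fin.succ j ≠ Fin.castSucc j' ∧ Fin.succ j ≠ Fin.succ j' := by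
  refine ⟨?_, ?_, ?_, ?_⟩ <;> intro e <;> have := congrArg Fin.val e <;>
    simp only [Fin.val_succ, Fin.val_castSucc] at this <;> omega

omit Ω in
/-- **The transpositions of disjoint pairs commute.** [folklore] -/
theorem ptPerm_comm_of_apart {j j' : Fin K} (h : (j : ℕ) + 2 ≤ j' ∨ (j' : ℕ) + 2 ≤ j) (τ : Fin (K + 1)) :
    ptPerm K j (ptPerm K j' τ) = ptPerm K j' (ptPerm K j τ) := by
  obtain ⟨h1, h2, h3, h4⟩ := ptPair_ne_four_of_apart h
  have e1 : Fin.castSucc j ≠ Fin.succ j := ne_of_lt Fin.castSucc_lt_succ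
  have e2 : Fin.castSucc j' ≠ Fin.succ j' := ne_of_lt Fin.castSucc_lt_succ
  have hnd : [Fin.castSucc j, Fin.succ j, Fin.castSucc j', Fin.succ j'].Nodup := by
    simp [h1, h2, h3, h4, e1, e2]
  have hc := congrArg (fun e : Equiv.Perm (Fin (K + 1)) => e τ) (Equiv.Perm.disjoint_swap_swap hnd).commute.eq
  simpa only [ptPerm, Equiv.Perm.mul_apply] using hc

omit Ω in
/-- The transposition of the pair `j` fixes both levels of a disjoint pair `j'`. [folklore] -/
theorem ptPerm_castSucc_of_apart {j j' : Fin K} (h : (j : ℕ) + 2 ≤ j' ∨ (j' : ℕ) + 2 ≤ j) :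
    ptPerm K j (Fin.castSucc j') = Fin.castSucc j' := by
  obtain ⟨h1, _, h3, _⟩ := ptPair_ne_four_of_apart h
  exact Equiv.swap_apply_of_ne_of_ne h1.symm h3.symm

omit Ω in
/-- The transposition of the pair `j` fixes the upper level of a disjoint pair `j'`. [folklore] -/
theorem ptPerm_succ_of_apart {j j' : Fin K} (h : (j : ℕ) + 2 ≤ j' ∨ (j' : ℕ) + 2 ≤ j) :
    ptPerm K j (Fin.succ j') = Fin.succ j' := by
  obtain ⟨_, h2, _, h4⟩ := ptPair_ne_four_of_apart h
  exact Equiv.swap_apply_of_ne_of_ne h2.symm h4.symm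

omit Ω in
/-- **A tag moved by the pair `j'` is not moved by a disjoint pair `j`**: if `σ_{j'} τ ≠ τ` then `σ_j τ = τ`.
[folklore] -/
theorem ptPerm_eq_self_of_apart {j j' : Fin K} (h : (j : ℕ) + 2 ≤ j' ∨ (j' : ℕ) + 2 ≤ j) {τ : Fin (K + 1)}
    (hτ : ptPerm K j' τ ≠ τ) : ptPerm K j τ = τ := by
  rw [ptPerm_ne_self_iff] at hτ
  rcases hτ with rfl | rfl
  · exact ptPerm_castSucc_of_apart h
  · exact ptPerm_succ_of_apart h

/-- **The configuration swaps of disjoint pairs commute.** [folklore] -/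
theorem ptConfSwap_comm_of_apart {j j' : Fin K} (h : (j : ℕ) + 2 ≤ j' ∨ (j' : ℕ) + 2 ≤ j) (x : Fin (K + 1) → Ω) :
    ptConfSwap K j (ptConfSwap K j' x) = ptConfSwap K j' (ptConfSwap K j x) := by
  funext k
  simp only [ptConfSwap]
  rw [ptPerm_comm_of_apart h]

/-- **The proposal maps of disjoint pairs commute.** [folklore] -/
theorem ptSwapMap_comm_of_apart {j j' : Fin K} (h : (j : ℕ) + 2 ≤ j' ∨ (j' : ℕ) + 2 ≤ j) (z : Fin (K + 1) × (Fin (K + 1) → Ω)) :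
    ptSwapMap K j (ptSwapMap K j' z) = ptSwapMap K j' (ptSwapMap K j z) := by
  simp only [ptSwapMap]
  rw [ptPerm_comm_of_apart h, ptConfSwap_comm_of_apart h]

/-- The swap of the pair `j` leaves the configurations at the levels of a disjoint pair `j'` in place. [folklore] -/
theorem ptConfSwap_apply_castSucc_of_apart {j j' : Fin K} (h : (j : ℕ) + 2 ≤ j' ∨ (j' : ℕ) + 2 ≤ j) (x : Fin (K + 1) → Ω) :
    ptConfSwap K j x (Fin.castSucc j') = x (Fin.castSucc j') := by
  simp only [ptConfSwap, ptPerm_castSucc_of_apart h]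

/-- The swap of the pair `j` leaves the configuration at the upper level of a disjoint pair `j'` in place.
[folklore] -/
theorem ptConfSwap_apply_succ_of_apart {j j' : Fin K} (h : (j : ℕ) + 2 ≤ j' ∨ (j' : ℕ) + 2 ≤ j) (x : Fin (K + 1) → Ω) :
    ptConfSwap K j x (Fin.succ j') = x (Fin.succ j') := by
  simp only [ptConfSwap, ptPerm_succ_of_apart h]

variable {X : Ω → ℝ} {β : ℕ → ℝ}

/-- **The swap of the pair `j` does not change the Metropolis ratio of a disjoint pair `j'`.** [ours] -/
theorem ptPairRatio_confSwap_of_apart {j j' : Fin K} (h : (j : ℕ) + 2 ≤ j' ∨ (j' : ℕ) + 2 ≤ j) (x : Fin (K + 1) → Ω) :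
    ptPairRatio X β K j' (ptConfSwap K j x) = ptPairRatio X β K j' x := by
  unfold ptPairRatio
  rw [ptConfSwap_apply_castSucc_of_apart h, ptConfSwap_apply_succ_of_apart h]

end Apart

/-! ## §2 The pair kernel -/

section KernelDef

variable {Ω : Type*} [MeasurableSpace Ω] {K : ℕ} {X : Ω → ℝ} {β : ℕ → ℝ}

/-- The pair transition measure on a measurable set. [ours] -/
theorem ptPairMeasure_apply' (j : Fin K) (z : Fin (K + 1) × (Fin (K + 1) → Ω))
    {s : Set (Fin (K + 1) × (Fin (K + 1) → Ω))} (hs : MeasurableSet s) :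
    ptPairMeasure X β K j z s = ENNReal.ofReal (ptPairRatio X β K j z.2) * s.indicator 1 (ptSwapMap K j z) +
      ENNReal.ofReal (1 - ptPairRatio X β K j z.2) * s.indicator 1 z := by
  simp only [ptPairMeasure, Measure.coe_add, Measure.coe_smul, Pi.add_apply, Pi.smul_apply, smul_eq_mul,
    Measure.dirac_apply' _ hs]

/-- `z ↦ κ_j(z, ·)` is measurable (for measurable `X`). [ours] -/
theorem measurable_ptPairMeasure (hXm : Measurable X) (j : Fin K) : Measurable (ptPairMeasure X β K j) := by
  refine Measure.measurable_of_measurable_coe _ fun s hsm => ?_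
  simp only [ptPairMeasure_apply' j _ hsm]
  have hr : Measurable fun z : Fin (K + 1) × (Fin (K + 1) → Ω) => ENNReal.ofReal (ptPairRatio X β K j z.2) :=
    ((measurable_ptPairRatio (β := β) hXm j).comp measurable_snd).ennreal_ofReal
  have hr' : Measurable fun z : Fin (K + 1) × (Fin (K + 1) → Ω) => ENNReal.ofReal (1 - ptPairRatio X β K j z.2) :=
    (measurable_const.sub ((measurable_ptPairRatio (β := β) hXm j).comp measurable_snd)).ennreal_ofReal
  have h1 : Measurable fun z : Fin (K + 1) × (Fin (K + 1) → Ω) =>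
      s.indicator (1 : Fin (K + 1) × (Fin (K + 1) → Ω) → ℝ≥0∞) (ptSwapMap K j z) :=
    measurable_indicator_one_comp (measurable_ptSwapMap j) hsm
  have h2 : Measurable fun z : Fin (K + 1) × (Fin (K + 1) → Ω) =>
      s.indicator (1 : Fin (K + 1) × (Fin (K + 1) → Ω) → ℝ≥0∞) z :=
    measurable_indicator_one_comp measurable_id hsm
  exact (hr.mul h1).add (hr'.mul h2)

/-- **THE PAIR SWAP KERNEL** `κ_j` on the tagged space: attempt the exchange of the configurations at the levels
`j`, `j+1` with the exact Metropolis probability `ptPairRatio`; the tag follows its configuration. [ours] -/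
def ptPairKernel {X : Ω → ℝ} (hXm : Measurable X) (β : ℕ → ℝ) (K : ℕ) (j : Fin K) :
    Kernel (Fin (K + 1) × (Fin (K + 1) → Ω)) (Fin (K + 1) × (Fin (K + 1) → Ω)) :=
  ⟨ptPairMeasure X β K j, measurable_ptPairMeasure hXm j⟩

/-- The pair kernel at `z` is the pair transition measure. [ours] -/
theorem ptPairKernel_apply (hXm : Measurable X) (j : Fin K) (z : Fin (K + 1) × (Fin (K + 1) → Ω)) :
    ptPairKernel hXm β K j z = ptPairMeasure X β K j z := rfl

/-- The pair kernel on a measurable set. [ours] -/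
theorem ptPairKernel_apply' (hXm : Measurable X) (j : Fin K) (z : Fin (K + 1) × (Fin (K + 1) → Ω))
    {s : Set (Fin (K + 1) × (Fin (K + 1) → Ω))} (hs : MeasurableSet s) :
    ptPairKernel hXm β K j z s = ENNReal.ofReal (ptPairRatio X β K j z.2) * s.indicator 1 (ptSwapMap K j z) +
      ENNReal.ofReal (1 - ptPairRatio X β K j z.2) * s.indicator 1 z := by
  rw [ptPairKernel_apply, ptPairMeasure_apply' j _ hs]

omit [MeasurableSpace Ω] in
/-- `r_j + (1 − r_j) = 1` in `ℝ≥0∞`. [folklore] -/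
theorem ofReal_ptPairRatio_add (j : Fin K) (x : Fin (K + 1) → Ω) :
    ENNReal.ofReal (ptPairRatio X β K j x) + ENNReal.ofReal (1 - ptPairRatio X β K j x) = 1 := by
  rw [← ENNReal.ofReal_add (ptPairRatio_mem j x).1 (one_sub_ptPairRatio_nonneg j x), add_sub_cancel,
    ENNReal.ofReal_one]

/-- The pair kernel is MARKOV (for every `K`). [ours] -/
instance isMarkovKernel_ptPairKernel (hXm : Measurable X) (j : Fin K) : IsMarkovKernel (ptPairKernel hXm β K j) := by
  refine ⟨fun z => ⟨?_⟩⟩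
  rw [ptPairKernel_apply' hXm j z MeasurableSet.univ]
  simp only [Set.indicator_univ, Pi.one_apply, mul_one]
  exact ofReal_ptPairRatio_add j z.2

/-- Integration against the pair kernel: `∫⁻ g dκ_j(z,·) = r_j·g(swap_j z) + (1 − r_j)·g(z)`. [ours] -/
theorem lintegral_ptPairKernel (hXm : Measurable X) (j : Fin K) {g : Fin (K + 1) × (Fin (K + 1) → Ω) → ℝ≥0∞}
    (hg : Measurable g) (z : Fin (K + 1) × (Fin (K + 1) → Ω)) :
    ∫⁻ y, g y ∂(ptPairKernel hXm β K j z) =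
      ENNReal.ofReal (ptPairRatio X β K j z.2) * g (ptSwapMap K j z) +
        ENNReal.ofReal (1 - ptPairRatio X β K j z.2) * g z := by
  rw [ptPairKernel_apply]
  simp only [ptPairMeasure, lintegral_add_measure, lintegral_smul_measure, lintegral_dirac' _ hg, smul_eq_mul]

/-- **Consistency with GEN-14's swap kernel**: the uniformly-chosen-pair kernel is the average of the pair kernels,
`ptSwapKernel z s = K⁻¹·Σ_j κ_j(z, s)`. [ours] -/
theorem ptSwapKernel_apply_eq_sum_pairKernel (hXm : Measurable X) (z : Fin (K + 1) × (Fin (K + 1) → Ω))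
    {s : Set (Fin (K + 1) × (Fin (K + 1) → Ω))} (hs : MeasurableSet s) :
    ptSwapKernel hXm β K z s = ((K : ℕ) : ℝ≥0∞)⁻¹ * ∑ j : Fin K, ptPairKernel hXm β K j z s := by
  rw [ptSwapKernel_apply' hXm z hs]
  simp only [ptPairKernel_apply' hXm _ z hs]

end KernelDef

/-! ## §3 Detailed balance of the pair kernel -/

section Balance

variable {Ω : Type*} [MeasurableSpace Ω] {X : Ω → ℝ} {μ : Measure Ω} {β : ℕ → ℝ} {K : ℕ}

/-- **`∫⁻_A κ_j(·, B) dπ = (K+1)⁻¹·(T_j(A,B) + S_j(A,B))`** with GEN-14's swap-flux / stay functionals. [ours] -/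
theorem setLIntegral_ptPairKernel (hXm : Measurable X) (j : Fin K) {A B : Set (Fin (K + 1) × (Fin (K + 1) → Ω))}
    (hA : MeasurableSet A) (hB : MeasurableSet B) :
    ∫⁻ z in A, ptPairKernel hXm β K j z B ∂(ptTaggedTarget X μ β K) =
      ((K + 1 : ℕ) : ℝ≥0∞)⁻¹ * (ptSwapFlux X μ β K j A B + ptSwapStay X μ β K j A B) := by
  rw [← lintegral_indicator hA,
    lintegral_ptTaggedTarget (((ptPairKernel hXm β K j).measurable_coe hB).indicator hA)]
  congr 1
  -- pointwise expansion of `1_A(z)·κ_j(z,B)`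
  have hpt : ∀ (τ : Fin (K + 1)) (x : Fin (K + 1) → Ω),
      A.indicator (fun z => ptPairKernel hXm β K j z B) ((τ, x)) =
        A.indicator 1 ((τ, x) : Fin (K + 1) × (Fin (K + 1) → Ω)) * B.indicator 1 (ptSwapMap K j (τ, x)) *
            ENNReal.ofReal (ptPairRatio X β K j x) +
          A.indicator 1 ((τ, x) : Fin (K + 1) × (Fin (K + 1) → Ω)) *
            B.indicator 1 ((τ, x) : Fin (K + 1) × (Fin (K + 1) → Ω)) * ENNReal.ofReal (1 - ptPairRatio X β K j x) := by
    intro τ x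
    by_cases hz : ((τ, x) : Fin (K + 1) × (Fin (K + 1) → Ω)) ∈ A
    · rw [Set.indicator_of_mem hz, Set.indicator_of_mem hz, ptPairKernel_apply' hXm j _ hB]
      simp only [Pi.one_apply, one_mul]
      ring
    · rw [Set.indicator_of_notMem hz, Set.indicator_of_notMem hz]
      simp
  have hiA : ∀ τ : Fin (K + 1), Measurable fun x : Fin (K + 1) → Ω =>
      A.indicator (1 : Fin (K + 1) × (Fin (K + 1) → Ω) → ℝ≥0∞) ((τ, x)) :=
    fun τ => measurable_indicator_one_comp measurable_prodMk_left hA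
  have hiB : ∀ τ : Fin (K + 1), Measurable fun x : Fin (K + 1) → Ω =>
      B.indicator (1 : Fin (K + 1) × (Fin (K + 1) → Ω) → ℝ≥0∞) ((τ, x)) :=
    fun τ => measurable_indicator_one_comp measurable_prodMk_left hB
  have hiBs : ∀ τ : Fin (K + 1), Measurable fun x : Fin (K + 1) → Ω =>
      B.indicator (1 : Fin (K + 1) × (Fin (K + 1) → Ω) → ℝ≥0∞) (ptSwapMap K j (τ, x)) :=
    fun τ => measurable_indicator_one_comp ((measurable_ptSwapMap j).comp measurable_prodMk_left) hB
  have hr : Measurable fun x : Fin (K + 1) → Ω => ENNReal.ofReal (ptPairRatio X β K j x) :=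
    (measurable_ptPairRatio (β := β) hXm j).ennreal_ofReal
  have hr' : Measurable fun x : Fin (K + 1) → Ω => ENNReal.ofReal (1 - ptPairRatio X β K j x) :=
    (measurable_const.sub (measurable_ptPairRatio (β := β) hXm j)).ennreal_ofReal
  have hT : ∀ τ : Fin (K + 1), Measurable fun x : Fin (K + 1) → Ω =>
      A.indicator 1 ((τ, x) : Fin (K + 1) × (Fin (K + 1) → Ω)) * B.indicator 1 (ptSwapMap K j (τ, x)) *
        ENNReal.ofReal (ptPairRatio X β K j x) := fun τ => ((hiA τ).mul (hiBs τ)).mul hr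
  have hτ : ∀ τ : Fin (K + 1), ∫⁻ x, A.indicator (fun z => ptPairKernel hXm β K j z B) ((τ, x))
      ∂(Measure.pi fun k : Fin (K + 1) => μ.tilted fun x => β k * X x) =
      (∫⁻ x, A.indicator 1 ((τ, x) : Fin (K + 1) × (Fin (K + 1) → Ω)) * B.indicator 1 (ptSwapMap K j (τ, x)) *
          ENNReal.ofReal (ptPairRatio X β K j x) ∂(Measure.pi fun k : Fin (K + 1) => μ.tilted fun x => β k * X x)) +
        ∫⁻ x, A.indicator 1 ((τ, x) : Fin (K + 1) × (Fin (K + 1) → Ω)) *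
          B.indicator 1 ((τ, x) : Fin (K + 1) × (Fin (K + 1) → Ω)) * ENNReal.ofReal (1 - ptPairRatio X β K j x)
            ∂(Measure.pi fun k : Fin (K + 1) => μ.tilted fun x => β k * X x) := by
    intro τ
    simp only [hpt]
    rw [lintegral_add_left (hT τ)]
  simp only [hτ, Finset.sum_add_distrib, ptSwapFlux, ptSwapStay]

/-- **DETAILED BALANCE: THE PAIR KERNEL IS REVERSIBLE WITH RESPECT TO THE TAGGED TARGET** (`μ` a probability
measure, `X` bounded measurable). [ours] -/
theorem isReversible_ptPairKernel [IsProbabilityMeasure μ] (hXm : Measurable X) (hXb : ∃ C, ∀ x, |X x| ≤ C)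
    (j : Fin K) : Kernel.IsReversible (ptPairKernel hXm β K j) (ptTaggedTarget X μ β K) := by
  intro A B hA hB
  rw [setLIntegral_ptPairKernel hXm j hA hB, setLIntegral_ptPairKernel hXm j hB hA, ptSwapFlux_comm hXm hXb j hA hB,
    ptSwapStay_comm j A B]

/-- **(i) THE PAIR KERNEL LEAVES THE TAGGED TARGET INVARIANT.** [ours] -/
theorem invariant_ptPairKernel [IsProbabilityMeasure μ] (hXm : Measurable X) (hXb : ∃ C, ∀ x, |X x| ≤ C)
    (j : Fin K) : Kernel.Invariant (ptPairKernel hXm β K j) (ptTaggedTarget X μ β K) :=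
  (isReversible_ptPairKernel hXm hXb j).invariant

end Balance

/-! ## §4 (ii) nearest-neighbour tag moves; (iii) the exact tag-move probability -/

section Moves

variable {Ω : Type*} [MeasurableSpace Ω] {X : Ω → ℝ} {β : ℕ → ℝ} {K : ℕ}

/-- **(ii) THE PAIR KERNEL MOVES THE TAG BY AT MOST ONE LEVEL.** [ours] -/
theorem ptPairKernel_nearestNeighbour (hXm : Measurable X) (j : Fin K) (z : Fin (K + 1) × (Fin (K + 1) → Ω)) :
    ∀ᵐ y ∂(ptPairKernel hXm β K j z), |(((y.1 : Fin (K + 1)) : ℕ) : ℝ) - ((z.1 : Fin (K + 1)) : ℕ)| ≤ 1 := by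
  rw [ae_iff]
  set S : Set (Fin (K + 1) × (Fin (K + 1) → Ω)) :=
    {y | ¬ |(((y.1 : Fin (K + 1)) : ℕ) : ℝ) - ((z.1 : Fin (K + 1)) : ℕ)| ≤ 1} with hS_def
  have e : S = (fun y : Fin (K + 1) × (Fin (K + 1) → Ω) => ((y.1 : Fin (K + 1)) : ℕ)) ⁻¹'
      {n : ℕ | ¬ |((n : ℕ) : ℝ) - ((z.1 : Fin (K + 1)) : ℕ)| ≤ 1} := by
    ext y; simp [hS_def]
  have hS : MeasurableSet S := by rw [e]; exact measurable_ptLevel MeasurableSet.of_discrete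
  rw [ptPairKernel_apply' hXm j z hS]
  have h1 : ptSwapMap K j z ∉ S := by
    rw [hS_def, Set.mem_setOf_eq, not_not]; exact abs_ptPerm_sub_le_one j z.1
  have h2 : z ∉ S := by
    rw [hS_def, Set.mem_setOf_eq, not_not, sub_self, abs_zero]; exact zero_le_one
  simp [Set.indicator_of_notMem h1, Set.indicator_of_notMem h2]

/-- **(iii) THE EXACT PROBABILITY THAT THE PAIR KERNEL MOVES THE TAG**:
`κ_j(z){tag ≠ tag z} = ptTagCoef K j (tag z)·r_j(z)` — the Metropolis ratio if the tag sits on the pair, zero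
otherwise. [ours] -/
theorem ptPairKernel_real_moves_eq (hXm : Measurable X) (j : Fin K) (z : Fin (K + 1) × (Fin (K + 1) → Ω)) :
    (ptPairKernel hXm β K j z).real {y | ((y.1 : Fin (K + 1)) : ℕ) ≠ ((z.1 : Fin (K + 1)) : ℕ)} =
      ptTagCoef K j z.1 * ptPairRatio X β K j z.2 := by
  set S : Set (Fin (K + 1) × (Fin (K + 1) → Ω)) := {y | ((y.1 : Fin (K + 1)) : ℕ) ≠ ((z.1 : Fin (K + 1)) : ℕ)}
    with hS_def
  have e : S = (fun y : Fin (K + 1) × (Fin (K + 1) → Ω) => ((y.1 : Fin (K + 1)) : ℕ)) ⁻¹'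
      {n : ℕ | n ≠ ((z.1 : Fin (K + 1)) : ℕ)} := by
    ext y; simp [hS_def]
  have hS : MeasurableSet S := by rw [e]; exact measurable_ptLevel MeasurableSet.of_discrete
  rw [measureReal_def, ptPairKernel_apply' hXm j z hS]
  have hz : z ∉ S := by simp [hS_def]
  rw [Set.indicator_of_notMem hz, mul_zero, add_zero]
  by_cases hne : ptPerm K j z.1 ≠ z.1
  · have hmem : ptSwapMap K j z ∈ S := by
      rw [hS_def, Set.mem_setOf_eq]
      exact fun h => hne (Fin.ext h)
    rw [Set.indicator_of_mem hmem, Pi.one_apply, mul_one, ptTagCoef_eq_one_of_ne j z.1 hne, one_mul,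
      ENNReal.toReal_ofReal (ptPairRatio_mem j z.2).1]
  · push Not at hne
    have hnot : ptSwapMap K j z ∉ S := by
      rw [hS_def, Set.mem_setOf_eq, not_not]
      show ((ptPerm K j z.1 : Fin (K + 1)) : ℕ) = ((z.1 : Fin (K + 1)) : ℕ)
      rw [hne]
    -- the tag does not sit on the pair, so its incidence coefficient vanishes
    have h' : ¬ (z.1 = Fin.castSucc j ∨ z.1 = Fin.succ j) := fun hor => ((ptPerm_ne_self_iff j z.1).2 hor) hne
    push Not at h'
    have hcoef : ptTagCoef K j z.1 = 0 := by
      unfold ptTagCoef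
      rw [if_neg (Ne.symm h'.1), if_neg (Ne.symm h'.2), add_zero]
    rw [Set.indicator_of_notMem hnot, mul_zero, hcoef, zero_mul, ENNReal.toReal_zero]

/-- **(iii') THE PAIR KERNEL MOVES THE TAG WITH PROBABILITY AT MOST `ptSwapRatio`** — hypothesis `hmove` of
GEN-13's `pt_level_lagOneAutocorr_ge`, so every law of `Scaling/ParallelTemperingDiffusive` /
`Scaling/ParallelTemperingAlgorithm` holds for `M ∘ₖ κ_j` as well. [ours] -/
theorem ptPairKernel_real_moves_le (hXm : Measurable X) (j : Fin K) (z : Fin (K + 1) × (Fin (K + 1) → Ω)) :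
    (ptPairKernel hXm β K j z).real {y | ((y.1 : Fin (K + 1)) : ℕ) ≠ ((z.1 : Fin (K + 1)) : ℕ)} ≤
      ptSwapRatio X β K z := by
  rw [ptPairKernel_real_moves_eq hXm j z, ptSwapRatio]
  exact Finset.single_le_sum (f := fun j' => ptTagCoef K j' z.1 * ptPairRatio X β K j' z.2)
    (fun j' _ => mul_nonneg (ptTagCoef_mem j' z.1).1 (ptPairRatio_mem j' z.2).1) (Finset.mem_univ j)

end Moves

/-! ## §5 The kernels of disjoint pairs commute -/

section Commute

variable {Ω : Type*} [MeasurableSpace Ω] {X : Ω → ℝ} {β : ℕ → ℝ} {K : ℕ}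

/-- The composition of two pair kernels on a measurable set: four atoms. [ours] -/
theorem ptPairKernel_comp_apply' (hXm : Measurable X) (j j' : Fin K) (z : Fin (K + 1) × (Fin (K + 1) → Ω))
    {s : Set (Fin (K + 1) × (Fin (K + 1) → Ω))} (hs : MeasurableSet s) :
    (ptPairKernel hXm β K j' ∘ₖ ptPairKernel hXm β K j) z s =
      ENNReal.ofReal (ptPairRatio X β K j z.2) *
          (ENNReal.ofReal (ptPairRatio X β K j' (ptConfSwap K j z.2)) * s.indicator 1 (ptSwapMap K j' (ptSwapMap K j z)) +
            ENNReal.ofReal (1 - ptPairRatio X β K j' (ptConfSwap K j z.2)) * s.indicator 1 (ptSwapMap K j z)) +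
        ENNReal.ofReal (1 - ptPairRatio X β K j z.2) *
          (ENNReal.ofReal (ptPairRatio X β K j' z.2) * s.indicator 1 (ptSwapMap K j' z) +
            ENNReal.ofReal (1 - ptPairRatio X β K j' z.2) * s.indicator 1 z) := by
  rw [Kernel.comp_apply' _ _ _ hs, lintegral_ptPairKernel hXm j ((ptPairKernel hXm β K j').measurable_coe hs)]
  simp only [ptPairKernel_apply' hXm j' _ hs]
  rfl

/-- **THE SWAP KERNELS OF DISJOINT PAIRS COMMUTE**: `κ_{j'} ∘ₖ κ_j = κ_j ∘ₖ κ_{j'}` when the pairs `(j, j+1)`,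
`(j', j'+1)` are two levels apart. [ours] -/
theorem ptPairKernel_comm_of_apart (hXm : Measurable X) {j j' : Fin K} (h : (j : ℕ) + 2 ≤ j' ∨ (j' : ℕ) + 2 ≤ j) :
    ptPairKernel hXm β K j' ∘ₖ ptPairKernel hXm β K j = ptPairKernel hXm β K j ∘ₖ ptPairKernel hXm β K j' := by
  ext z s hs
  rw [ptPairKernel_comp_apply' hXm j j' z hs, ptPairKernel_comp_apply' hXm j' j z hs,
    ptPairRatio_confSwap_of_apart h, ptPairRatio_confSwap_of_apart (Or.symm h), ptSwapMap_comm_of_apart (Or.symm h)]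
  ring

end Commute

end Summit.Ventures.LatticeQCDFlow.Scaling

end
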